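import Summits.BirchSwinnertonDyer.BirchSwinnertonDyer.Theorems.ManinLocalTwoThreeManinOddOfOddEtaExponent
import Literature.NumberTheory.EllipticCurves.ModTwoReducibleIffTwoTorsionRoot
import Mathlib.RingTheory.Polynomial.RationalRoot
import Literature.NumberTheory.EllipticCurves.VariableChangePointsMap
import Literature.NumberTheory.EllipticCurves.LFunctionSmulProofs
import Literature.NumberTheory.EllipticCurves.GlobalMinimalModelProofs
import HarnessLib

/-!
# The reducible residual `Rb` of `ManinOddAtFour` from an's three rows, for EVERY global minimal model
# (model glue: transport of the parametrisation datum along `(1, 0, −a₁/2, −a₃/2)`)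

Summit `BirchSwinnertonDyer`, route `ManinLocalTwoThree` (cell bsd-f2-manin), deciding crux C2
`ManinOddAtFour` (stmt-BirchSwinnertonDyer-22967), stub 6 `stub_minimalReducibleResidual` (Rb) of the line
`kato_shift_two`.  The sibling `ManinLocalTwoThreeRbNormalFormOfKummerRows` proves MEMO-an §56.6's glue on models
with `a₁ = a₃ = 0`; this file (independent of it) removes that restriction:

* `exists_modularParametrizationData_smul_one_zero` — **model glue**: a modular parametrisation datum `D`
  of `W` at level `N` transports along any change of variables `C = (1, 0, s, t)` to a datum of `C • W`
  with the SAME newform, period pair, Manin constant and degree (uniformisation composed with the tree's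
  `VariableChange.pointEquivBaseChange`; `c₄, c₆, b₂` and `ω` are unchanged);
* `isGloballyMinimal_smul_one_zero_int` — `(1, 0, s, t) • W` is again globally minimal for `s, t ∈ ℤ`;
* `rb_of_kgeo_of_oddExponent_of_blindResidual` — **granting E-an-48 (K_geo), E-an-53 and E-an-50, every
  lattice-optimal `X₀(N)`-datum (`4 ∣ N`) of a globally minimal `W` with REDUCIBLE `W[2]` has odd Manin
  constant**: `4 ∣ N` makes `2` additive, so `a₁, a₃` are even (`even_a₁_and_even_a₃_of_hasAdditiveReductionAt_two`)
  and `(1, 0, −a₁/2, −a₃/2)` reaches the normal form, where the §56.6 argument runs (E-an-52 inside).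

So, BY NAME and in the tree: `stub_minimalReducibleResidual`'s conclusion follows — for ALL its `W`, ignoring
its twist-minimality binders — from an's three open rows {`CuspidalKummerRepresentativeAtFour`,
`CuspidalKummerOddExponent`, `KummerBlindResidualOdd`}.  HONEST FRAMING: a CONDITIONAL reduction; K_geo is a
generalized-Ogg statement, E-an-53 is C2-equivalent on its locus, E-an-50 is the totally blind residual; nothing
about BSD or Manin's conjecture is proved here.
-/

set_option autoImplicit false
set_option linter.dupNamespace false

noncomputable section

open scoped Classical MatrixGroups ModularForm
open CongruenceSubgroup IsDedekindDomain NumberField WeierstrassCurve Literature.NumberTheory.EllipticCurves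
  Literature.NumberTheory.EllipticCurves.ModularForms
open UpperHalfPlane hiding I
open Polynomial PowerSeries Literature.RingTheory.FormalGroups
open Summit.BirchSwinnertonDyer.Rank1Residual.ManinAdditive.CuspidalKummer

namespace Summit.BirchSwinnertonDyer.BirchSwinnertonDyer.Theorems.ManinLocalTwoThree

/-- On a model with `a₁ = a₃ = 0` and integral `a₂, a₄, a₆`, a rational root of the 2-division cubic
`4x³ + b₂x² + 2b₄x + b₆ = 4(x³ + a₂x² + a₄x + a₆)` is an integer (rational root theorem for the monic
integer cubic). [folklore] -/
private theorem exists_int_eq_of_isRoot_twoTorsionPolynomial_of_a₁_a₃' (W : WeierstrassCurve ℚ) {a₂ a₄ a₆ : ℤ}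
    (h₁ : W.a₁ = 0) (h₃ : W.a₃ = 0) (ha₂ : W.a₂ = a₂) (ha₄ : W.a₄ = a₄) (ha₆ : W.a₆ = a₆) {e : ℚ}
    (he : W.twoTorsionPolynomial.toPoly.IsRoot e) : ∃ e₀ : ℤ, (e₀ : ℚ) = e := by
  have hcub : e ^ 3 + (a₂ : ℚ) * e ^ 2 + (a₄ : ℚ) * e + (a₆ : ℚ) = 0 := by
    have h := (isRoot_twoTorsionPolynomial_iff W e).mp he
    simp only [WeierstrassCurve.b₂, WeierstrassCurve.b₄, WeierstrassCurve.b₆, h₁, h₃, ha₂, ha₄, ha₆] at h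
    linear_combination (1 / 4 : ℚ) * h
  set P : Cubic ℤ := ⟨1, a₂, a₄, a₆⟩ with hP
  have hmonic : P.toPoly.Monic := Cubic.monic_of_a_eq_one rfl
  have haeval : aeval e P.toPoly = 0 := by
    simp only [hP, Cubic.toPoly, map_add, map_mul, map_pow, aeval_X, map_one, one_mul, eq_intCast,
      map_intCast]
    linear_combination hcub
  obtain ⟨e₀, he₀, -⟩ := exists_integer_of_is_root_of_monic hmonic haeval
  exact ⟨e₀, by rw [he₀, eq_intCast]⟩

/-- **Transport of a modular parametrisation datum along a change of variables `(1, 0, s, t)`.**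
For `C = (1, 0, s, t)` (so `x' = x`, `y' = y − s x − t`, `ω' = ω`, same Néron lattice, same
`c₄, c₆, b₂`), a datum `D` for `W` at level `N` yields one for `C • W` with the SAME newform, period
pair, Manin constant and degree: the uniformisation is `D`'s followed by the induced isomorphism of
point groups (`VariableChange.pointEquivBaseChange`). (In the cell bsd-f2-manin this is the «model
glue»: at additive `2` a global minimal model has `a₁, a₃` even and `(1, 0, −a₁/2, −a₃/2)` reaches the
`a₁ = a₃ = 0` normal form of MEMO-an §58.1.) [folklore] -/
theorem exists_modularParametrizationData_smul_one_zero {N : ℕ} [NeZero N] {W : WeierstrassCurve ℚ}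
    [W.IsElliptic] (D : ModularParametrizationData W N) (s t : ℚ) :
    ∃ D' : ModularParametrizationData ((⟨1, 0, s, t⟩ : VariableChange ℚ) • W) N,
      D'.f = D.f ∧ D'.c = D.c ∧ D'.L = D.L ∧ D'.deg = D.deg := by
  set C : VariableChange ℚ := ⟨1, 0, s, t⟩ with hC
  set e := VariableChange.pointEquivBaseChange W C ℂ with he
  have hu : C.u = 1 := rfl
  have hr : C.r = 0 := rfl
  refine ⟨{ f := D.f
            isNewformOf := ⟨D.isNewformOf.1, fun n => by rw [D.isNewformOf.2 n, LFunction_smul]⟩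
            L := D.L
            isNeronLattice := ?_
            uniformize := e.toAddMonoidHom.comp D.uniformize
            ker_uniformize := ?_
            uniformize_surjective := e.surjective.comp D.uniformize_surjective
            uniformize_spec := ?_
            c := D.c
            smul_periodLattice_le := D.smul_periodLattice_le
            deg := D.deg
            deg_pos := D.deg_pos
            deg_spec := ?_ }, rfl, rfl, rfl, rfl⟩
  · -- Néron lattice: `c₄, c₆` are invariant under `u = 1`
    obtain ⟨h₂, h₃⟩ := D.isNeronLattice
    refine ⟨?_, ?_⟩
    · rw [h₂]; simp [WeierstrassCurve.baseChange, map_c₄, variableChange_c₄, hu]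
    · rw [h₃]; simp [WeierstrassCurve.baseChange, map_c₆, variableChange_c₆, hu]
  · -- kernel
    rw [← D.ker_uniformize]
    ext z
    simp only [SetLike.mem_coe, AddMonoidHom.mem_ker, AddMonoidHom.coe_comp, Function.comp_apply,
      AddEquiv.coe_toAddMonoidHom, map_eq_zero_iff e e.injective]
  · -- the explicit formula off the lattice
    intro z hz
    obtain ⟨h₀, hD⟩ := D.uniformize_spec z hz
    set X : ℂ := D.L.weierstrassP z - (W.baseChange ℂ).b₂ / 12 with hX
    set Y : ℂ := (D.L.derivWeierstrassP z - (W.baseChange ℂ).a₁ * X - (W.baseChange ℂ).a₃) / 2 with hY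
    have hx : (C.map (algebraMap ℚ ℂ)).toX X =
        D.L.weierstrassP z - ((C • W).baseChange ℂ).b₂ / 12 := by
      rw [VariableChange.toX_def]
      simp only [VariableChange.map, WeierstrassCurve.baseChange, map_b₂, variableChange_b₂, hu, hr,
        Units.map, map_one, inv_one, one_pow, Units.val_one, map_zero, sub_zero, one_mul, mul_zero,
        add_zero]
      simp [hX, WeierstrassCurve.baseChange]
    have hy : (C.map (algebraMap ℚ ℂ)).toY X Y =
        (D.L.derivWeierstrassP z - ((C • W).baseChange ℂ).a₁ * (D.L.weierstrassP z -
          ((C • W).baseChange ℂ).b₂ / 12) - ((C • W).baseChange ℂ).a₃) / 2 := by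
      rw [VariableChange.toY_def]
      simp only [VariableChange.map, WeierstrassCurve.baseChange, map_b₂, map_a₁, map_a₃, variableChange_b₂,
        variableChange_a₁, variableChange_a₃, hu, hr, Units.map, map_one, inv_one, one_pow, Units.val_one,
        map_zero, sub_zero, one_mul, mul_zero, zero_mul, add_zero]
      simp only [hY, hX, WeierstrassCurve.baseChange, map_b₂, map_a₁, map_a₃, map_add, map_mul, map_ofNat]
      ring
    have hns := ((VariableChange.baseChange_smul_eq W C ℂ) ▸
      (VariableChange.nonsingular_iff (W.baseChange ℂ) (C.map (algebraMap ℚ ℂ)) X Y).mpr h₀)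
    refine ⟨by rw [← hy, ← hx]; exact hns, ?_⟩
    rw [AddMonoidHom.coe_comp, Function.comp_apply, AddEquiv.coe_toAddMonoidHom, hD, he,
      VariableChange.pointEquivBaseChange_some]
    rw [Affine.Point.some.injEq]
    exact ⟨hx, hy⟩
  · -- degree: the bad set is the image of `D`'s bad set under the point bijection
    have hset : {P : ((C • W).baseChange ℂ).toAffine.Point |
        Nat.card {y : Y0 N // ∃ τ : ℍ, Y0.mk N τ = y ∧
          (e.toAddMonoidHom.comp D.uniformize) ((D.c : ℂ) * eichlerIntegral D.f τ) = P} ≠ D.deg} =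
        (fun P => e.symm P) ⁻¹' {P : (W.baseChange ℂ).toAffine.Point |
          Nat.card {y : Y0 N // ∃ τ : ℍ, Y0.mk N τ = y ∧
            D.uniformize ((D.c : ℂ) * eichlerIntegral D.f τ) = P} ≠ D.deg} := by
      ext P
      simp only [Set.mem_setOf_eq, Set.mem_preimage, AddMonoidHom.coe_comp, Function.comp_apply,
        AddEquiv.coe_toAddMonoidHom]
      rw [Nat.card_congr (Equiv.subtypeEquivRight (fun y => ?_))]
      refine exists_congr fun τ => and_congr_right fun _ => ?_
      exact e.apply_eq_iff_symm_apply
    rw [hset]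
    exact D.deg_spec.preimage e.symm.injective.injOn

/-- `(1, 0, s, t) • W` is globally minimal when `W` is and `s, t ∈ ℤ` (every local minimality is
preserved by a `v`-integral change with `v`-unit `u`; integrality over `𝓞 ℚ` follows from local integrality).
[cite: SilvermanAEC2009, VII.1, Remark 1.1] -/
theorem isGloballyMinimal_smul_one_zero_int (W : WeierstrassCurve ℚ) [hW : W.IsGloballyMinimal] (s t : ℤ) :
    ((⟨1, 0, (s : ℚ), (t : ℚ)⟩ : VariableChange ℚ) • W).IsGloballyMinimal := by
  have hval : ∀ (v : HeightOneSpectrum (𝓞 ℚ)) (n : ℤ), v.valuation ℚ (n : ℚ) ≤ 1 := fun v n => by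
    simpa using HeightOneSpectrum.valuation_le_one (K := ℚ) v (n : 𝓞 ℚ)
  have hmin : ∀ v : HeightOneSpectrum (𝓞 ℚ),
      ((((⟨1, 0, (s : ℚ), (t : ℚ)⟩ : VariableChange ℚ) • W).baseChange (v.adicCompletion ℚ))).IsMinimal
        (v.adicCompletionIntegers ℚ) := fun v =>
    isMinimal_adicCompletion_smul (hW.isMinimal v) _ (by simp) (by simp) (hval v s) (hval v t)
  exact ⟨isIntegral_ringOfIntegers_of_forall_isMinimalAt _ hmin, hmin⟩

/-- **Rb from an's three rows, every global minimal model (MEMO-an §56.6 + §58.1 model glue), E-an-52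
discharged.**  Granting E-an-48, E-an-53, E-an-50: for globally minimal elliptic `W`, lattice-optimal `D`
at a level `N` with `4 ∣ N` and `W[2]` reducible, `2 ∤ c`.  CONDITIONAL on the three rows; nothing about
BSD or Manin's conjecture is proved. [folklore] -/
theorem rb_of_kgeo_of_oddExponent_of_blindResidual
    (h48 : CuspidalKummerRepresentativeAtFour) (h53 : CuspidalKummerOddExponent)
    (h50 : KummerBlindResidualOdd) :
    ∀ (W : WeierstrassCurve ℚ) [W.IsElliptic] [W.IsGloballyMinimal] {N : ℕ} [NeZero N]
      (D : ModularParametrizationData W N),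
      (∀ z ∈ D.L.lattice, ∃ w ∈ periodLattice D.f, z = D.c * w) → 4 ∣ N →
      ¬ W.HasIrreducibleModPGaloisRep 2 → ¬ (2 : ℤ) ∣ D.c := by
  intro W hWell hWmin N hN D hopt h4 hred
  -- `2` is additive, so `a₁, a₃` are even
  obtain ⟨ha2, hN2⟩ := lFunction_two_eq_zero_of_four_dvd W D.isNewformOf h4
  obtain ⟨⟨x, hx⟩, ⟨y, hy⟩⟩ := even_a₁_and_even_a₃_of_hasAdditiveReductionAt_two W
    (hasAdditiveReductionAt_two_of_lFunction_two_eq_zero W ha2 hN2)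
  set M : WeierstrassCurve ℤ := integralModelInt W with hM
  have hWM : M.map (Int.castRingHom ℚ) = W := map_integralModelInt W
  have ha₁ : W.a₁ = (x : ℚ) + x := by rw [← hWM, map_a₁, eq_intCast, hx]; push_cast; rfl
  have ha₃ : W.a₃ = (y : ℚ) + y := by rw [← hWM, map_a₃, eq_intCast, hy]; push_cast; rfl
  -- the normal form `W' = (1, 0, -x, -y) • W`
  set C : VariableChange ℚ := ⟨1, 0, ((-x : ℤ) : ℚ), ((-y : ℤ) : ℚ)⟩ with hC
  haveI : (C • W).IsGloballyMinimal := isGloballyMinimal_smul_one_zero_int W (-x) (-y)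
  have h₁ : (C • W).a₁ = 0 := by
    rw [variableChange_a₁, ha₁]; simp [hC]; ring
  have h₃ : (C • W).a₃ = 0 := by
    rw [variableChange_a₃, ha₃]; simp [hC]; ring
  have hT : (C • W).twoTorsionPolynomial = W.twoTorsionPolynomial := by
    simp [twoTorsionPolynomial, variableChange_b₂, variableChange_b₄, variableChange_b₆, hC]
  have hred' : ¬ (C • W).HasIrreducibleModPGaloisRep 2 := by
    obtain ⟨e, he⟩ := W.exists_isRoot_twoTorsionPolynomial_of_not_hasIrreducibleModPGaloisRep_two hred
    exact (C • W).not_hasIrreducibleModPGaloisRep_two_of_isRoot_twoTorsionPolynomial (x₀ := e)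
      (by rw [hT]; exact he)
  obtain ⟨D', hf, hc, hL, -⟩ :=
    exists_modularParametrizationData_smul_one_zero D (((-x : ℤ) : ℚ)) (((-y : ℤ) : ℚ))
  have hopt' : ∀ z ∈ D'.L.lattice, ∃ w ∈ periodLattice D'.f, z = D'.c * w := by
    rw [hL, hf, hc]; exact hopt
  rw [← hc]
  -- the §56.6 argument on the normal form `(C • W) = C • W` with the datum `D'`
  set M' : WeierstrassCurve ℤ := integralModelInt (C • W) with hM'
  have hWM' : M'.map (Int.castRingHom ℚ) = (C • W) := map_integralModelInt (C • W)
  have ha₂ : (C • W).a₂ = (M'.a₂ : ℚ) := by rw [← hWM', map_a₂, eq_intCast]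
  have ha₄ : (C • W).a₄ = (M'.a₄ : ℚ) := by rw [← hWM', map_a₄, eq_intCast]
  have ha₆ : (C • W).a₆ = (M'.a₆ : ℚ) := by rw [← hWM', map_a₆, eq_intCast]
  obtain ⟨e, he⟩ := (C • W).exists_isRoot_twoTorsionPolynomial_of_not_hasIrreducibleModPGaloisRep_two hred'
  obtain ⟨e₀, rfl⟩ := exists_int_eq_of_isRoot_twoTorsionPolynomial_of_a₁_a₃' (C • W) h₁ h₃ ha₂ ha₄ ha₆ he
  set a : ℕ → ℤ := fun n => (C • W).LFunction n with ha
  have han : ∀ n, (a n : ℂ) = cuspCoeff D'.f n := fun n => by rw [D'.isNewformOf.2 n]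
  set L : ℚ⟦X⟧ := lSeriesLog a with hLdef
  have hL0 : PowerSeries.constantCoeff L = 0 := by
    rw [hLdef, lSeriesLog, ← PowerSeries.coeff_zero_eq_constantCoeff, PowerSeries.coeff_mk]; simp
  set z : ℚ⟦X⟧ := (shortModel (C • W) D'.c).formalExp.subst L with hz
  have hzg : IsParamGerm (C • W) D'.c a z := by
    refine ⟨?_, ?_⟩
    · rw [hz, Literature.RingTheory.FormalGroups.constantCoeff_subst_of_constantCoeff_eq_zero hL0,
        constantCoeff_formalExp]
    · rw [hz, formalLog_subst_formalExp_subst _ hL0]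
  by_cases hall : ∀ e : ℤ, (C • W).twoTorsionPolynomial.toPoly.IsRoot (e : ℚ) → KummerBlindAtTwo M'.a₂ M'.a₄ e
  · exact h50 (C • W) D' hopt' h4 M'.a₂ M'.a₄ h₁ h₃ ha₂ ha₄ ⟨e₀, he⟩ hall
  · push Not at hall
    obtain ⟨e₁, he₁, hnb⟩ := hall
    obtain ⟨r, g, A, B, hrep⟩ := h48 (C • W) D' a han h4 hopt' (e₁ : ℚ) he₁ z hzg
    have hodd := h53 (C • W) D' a han h4 hopt' M'.a₂ M'.a₄ e₁ h₁ h₃ ha₂ ha₄ he₁ hnb z hzg r g A B hrep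
    exact ManinOddOfOddEtaExponent_holds (C • W) D' a han h4 (e₁ : ℚ) he₁ z hzg r g A B hrep hodd

end Summit.BirchSwinnertonDyer.BirchSwinnertonDyer.Theorems.ManinLocalTwoThree

end
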